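import Summits.Ventures.CertifiedManyBodySolver.Downfold.EmeryAxialSlabBi2223OPWindows
import Summits.Ventures.CertifiedManyBodySolver.Downfold.EmeryFermiFillingBi2223OP
import Summits.Ventures.CertifiedManyBodySolver.Downfold.EmeryFermiFillingLa214
import Summits.Ventures.CertifiedManyBodySolver.Downfold.EmeryAxialConductionBand
import HarnessLib

/-!
# Bi₂Sr₂Ca₂Cu₃O₁₀ OUTER plane (box #307 Bi-2223, (K) source rows): the axial co-shift census ON THE TYPED BOX `emeryBoxBi2223OPK14Src` — verdicts against the object-E row
# `t′/t ∈ [-0.422, -0.321]` and their FOUR-ORBITAL reading (companion of `EmeryAxialSlabBi2223OPWindows`, which carries the method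
# docstring, the slab table and the raw slab windows; the kernel certificates are in `EmeryAxialSlabBi2223OPSubs*`)

Venture CertifiedManyBodySolver, cell `pub/hubbard-downfold` (stage S1), seat hubbard-downfold-mod-4 (technique B); namespace
`Summit.Ventures.CertifiedManyBodySolver.Downfold.Emery`. Everything PROVED. READING (certified): `a ∈ [0.25, 0.3]` ⇒ the co-shifted window lies INSIDE the E row (`emeryBoxBi2223OPK14Src_axial_inside`).
WHAT THIS IS NOT: not a statement that the material's parameters ARE in the box (SCREENING-GRADE provenance); `U = 0` band kinematics; no phase
sentence; the E row is a [float] literature refit; `a_F` is the ADDITIONAL admixture beyond the box's σ rows (a model-form distance).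
Sources: [AndersenEtAl1995, §§5–6]; [PavariniEtAl2001, Eqs. (1)–(3), Fig. 3]; [HybertsenSchluterChristensen1989, Eq. (1)].
-/

noncomputable section

namespace Summit.Ventures.CertifiedManyBodySolver.Downfold.Emery

open Real Set
open Summit.Ventures.CertifiedManyBodySolver.Downfold

/-! ## §2 The typed box and the co-shift as a parameter -/

/-- The one-body rows and the per-spin filling of `emeryBoxBi2223OPK14Src` read by this file. [folklore] -/
theorem emeryBoxBi2223OPK14Src_axRows {p : EmeryCoord → ℝ} (hp : emeryBoxBi2223OPK14Src.Mem p) :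
    p .DeltaPd ∈ Set.Icc (39 / 20 : ℝ) (51 / 20 : ℝ) ∧ p .tpd ∈ Set.Icc (59 / 50 : ℝ) (139 / 100 : ℝ) ∧
      p .tpp ∈ Set.Icc (61 / 100 : ℝ) (18 / 25 : ℝ) ∧ p .tppP ∈ Set.Icc (7 / 50 : ℝ) (17 / 100 : ℝ) ∧
      (2 - p .nHoles) / 2 ∈ Set.Icc (803 / 2000 : ℝ) (211 / 500 : ℝ) := by
  obtain ⟨hΔ, ha, hb, hc, hn⟩ := emeryBoxBi2223OPK14Src_mem_rows hp
  exact ⟨hΔ, ha, hb, hc, abFilling_rowBi2223OP_of_nHoles hn.1 hn.2 rfl⟩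

/-- **Slab 0 on the typed box**: for every parameter vector of `emeryBoxBi2223OPK14Src`, every co-shift `a ∈ [0, 0.02]` and every Fermi energy at
which the CO-SHIFTED σ antibonding band holds the box's electrons: `ε ∈ [1.14, 2.1]`, `t′/t ∈ [-0.3224, -0.2438]` (MEETS).
[folklore] -/
theorem emeryBoxBi2223OPK14Src_axSlab0 :
    HoldsOn (fun p : EmeryCoord → ℝ => ∀ a ε : ℝ, a ∈ Set.Icc (0 : ℝ) (1 / 50 : ℝ) →
      abFilling (p .DeltaPd) (p .tpd) (p .tpp + a) (p .tppP + a) ε = (2 - p .nHoles) / 2 →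
      ε ∈ Set.Icc (57 / 50 : ℝ) (21 / 10 : ℝ) ∧
      fsRatio (p .DeltaPd) (p .tpd) (p .tpp + a) (p .tppP + a) ε ∈ Set.Icc (-(403 / 1250 : ℝ)) (-(1219 / 5000 : ℝ))) emeryBoxBi2223OPK14Src := by
  intro p hp a ε ha' hf
  obtain ⟨hΔ, ha, hb, hc, hν⟩ := emeryBoxBi2223OPK14Src_axRows hp
  rw [← hf] at hν
  exact bi2223OPAxSlab0_window hΔ ha ⟨by linarith [hb.1, ha'.1], by linarith [hb.2, ha'.2]⟩
    ⟨by linarith [hc.1, ha'.1], by linarith [hc.2, ha'.2]⟩ hν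

/-- **Slab 1 on the typed box**: for every parameter vector of `emeryBoxBi2223OPK14Src`, every co-shift `a ∈ [0.02, 0.05]` and every Fermi energy at
which the CO-SHIFTED σ antibonding band holds the box's electrons: `ε ∈ [1.12, 2.08]`, `t′/t ∈ [-0.3356, -0.2532]` (MEETS).
[folklore] -/
theorem emeryBoxBi2223OPK14Src_axSlab1 :
    HoldsOn (fun p : EmeryCoord → ℝ => ∀ a ε : ℝ, a ∈ Set.Icc (1 / 50 : ℝ) (1 / 20 : ℝ) →
      abFilling (p .DeltaPd) (p .tpd) (p .tpp + a) (p .tppP + a) ε = (2 - p .nHoles) / 2 →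
      ε ∈ Set.Icc (28 / 25 : ℝ) (52 / 25 : ℝ) ∧
      fsRatio (p .DeltaPd) (p .tpd) (p .tpp + a) (p .tppP + a) ε ∈ Set.Icc (-(839 / 2500 : ℝ)) (-(633 / 2500 : ℝ))) emeryBoxBi2223OPK14Src := by
  intro p hp a ε ha' hf
  obtain ⟨hΔ, ha, hb, hc, hν⟩ := emeryBoxBi2223OPK14Src_axRows hp
  rw [← hf] at hν
  exact bi2223OPAxSlab1_window hΔ ha ⟨by linarith [hb.1, ha'.1], by linarith [hb.2, ha'.2]⟩
    ⟨by linarith [hc.1, ha'.1], by linarith [hc.2, ha'.2]⟩ hν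

/-- **Slab 2 on the typed box**: for every parameter vector of `emeryBoxBi2223OPK14Src`, every co-shift `a ∈ [0.05, 0.1]` and every Fermi energy at
which the CO-SHIFTED σ antibonding band holds the box's electrons: `ε ∈ [1.08, 2.08]`, `t′/t ∈ [-0.3566, -0.2669]` (MEETS).
[folklore] -/
theorem emeryBoxBi2223OPK14Src_axSlab2 :
    HoldsOn (fun p : EmeryCoord → ℝ => ∀ a ε : ℝ, a ∈ Set.Icc (1 / 20 : ℝ) (1 / 10 : ℝ) →
      abFilling (p .DeltaPd) (p .tpd) (p .tpp + a) (p .tppP + a) ε = (2 - p .nHoles) / 2 →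
      ε ∈ Set.Icc (27 / 25 : ℝ) (52 / 25 : ℝ) ∧
      fsRatio (p .DeltaPd) (p .tpd) (p .tpp + a) (p .tppP + a) ε ∈ Set.Icc (-(1783 / 5000 : ℝ)) (-(2669 / 10000 : ℝ))) emeryBoxBi2223OPK14Src := by
  intro p hp a ε ha' hf
  obtain ⟨hΔ, ha, hb, hc, hν⟩ := emeryBoxBi2223OPK14Src_axRows hp
  rw [← hf] at hν
  exact bi2223OPAxSlab2_window hΔ ha ⟨by linarith [hb.1, ha'.1], by linarith [hb.2, ha'.2]⟩
    ⟨by linarith [hc.1, ha'.1], by linarith [hc.2, ha'.2]⟩ hν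

/-- **Slab 3 on the typed box**: for every parameter vector of `emeryBoxBi2223OPK14Src`, every co-shift `a ∈ [0.1, 0.2]` and every Fermi energy at
which the CO-SHIFTED σ antibonding band holds the box's electrons: `ε ∈ [1.02, 2.08]`, `t′/t ∈ [-0.3946, -0.2868]` (MEETS).
[folklore] -/
theorem emeryBoxBi2223OPK14Src_axSlab3 :
    HoldsOn (fun p : EmeryCoord → ℝ => ∀ a ε : ℝ, a ∈ Set.Icc (1 / 10 : ℝ) (1 / 5 : ℝ) →
      abFilling (p .DeltaPd) (p .tpd) (p .tpp + a) (p .tppP + a) ε = (2 - p .nHoles) / 2 →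
      ε ∈ Set.Icc (51 / 50 : ℝ) (52 / 25 : ℝ) ∧
      fsRatio (p .DeltaPd) (p .tpd) (p .tpp + a) (p .tppP + a) ε ∈ Set.Icc (-(1973 / 5000 : ℝ)) (-(717 / 2500 : ℝ))) emeryBoxBi2223OPK14Src := by
  intro p hp a ε ha' hf
  obtain ⟨hΔ, ha, hb, hc, hν⟩ := emeryBoxBi2223OPK14Src_axRows hp
  rw [← hf] at hν
  exact bi2223OPAxSlab3_window hΔ ha ⟨by linarith [hb.1, ha'.1], by linarith [hb.2, ha'.2]⟩
    ⟨by linarith [hc.1, ha'.1], by linarith [hc.2, ha'.2]⟩ hν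

/-- **Slab 4 on the typed box**: for every parameter vector of `emeryBoxBi2223OPK14Src`, every co-shift `a ∈ [0.2, 0.25]` and every Fermi energy at
which the CO-SHIFTED σ antibonding band holds the box's electrons: `ε ∈ [1.02, 1.98]`, `t′/t ∈ [-0.4083, -0.3187]` (MEETS).
[folklore] -/
theorem emeryBoxBi2223OPK14Src_axSlab4 :
    HoldsOn (fun p : EmeryCoord → ℝ => ∀ a ε : ℝ, a ∈ Set.Icc (1 / 5 : ℝ) (1 / 4 : ℝ) →
      abFilling (p .DeltaPd) (p .tpd) (p .tpp + a) (p .tppP + a) ε = (2 - p .nHoles) / 2 →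
      ε ∈ Set.Icc (51 / 50 : ℝ) (99 / 50 : ℝ) ∧
      fsRatio (p .DeltaPd) (p .tpd) (p .tpp + a) (p .tppP + a) ε ∈ Set.Icc (-(4083 / 10000 : ℝ)) (-(3187 / 10000 : ℝ))) emeryBoxBi2223OPK14Src := by
  intro p hp a ε ha' hf
  obtain ⟨hΔ, ha, hb, hc, hν⟩ := emeryBoxBi2223OPK14Src_axRows hp
  rw [← hf] at hν
  exact bi2223OPAxSlab4_window hΔ ha ⟨by linarith [hb.1, ha'.1], by linarith [hb.2, ha'.2]⟩
    ⟨by linarith [hc.1, ha'.1], by linarith [hc.2, ha'.2]⟩ hν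

/-- **Slab 5 on the typed box**: for every parameter vector of `emeryBoxBi2223OPK14Src`, every co-shift `a ∈ [0.25, 0.3]` and every Fermi energy at
which the CO-SHIFTED σ antibonding band holds the box's electrons: `ε ∈ [1.02, 1.96]`, `t′/t ∈ [-0.4219, -0.3324]` (INSIDE).
[folklore] -/
theorem emeryBoxBi2223OPK14Src_axSlab5 :
    HoldsOn (fun p : EmeryCoord → ℝ => ∀ a ε : ℝ, a ∈ Set.Icc (1 / 4 : ℝ) (3 / 10 : ℝ) →
      abFilling (p .DeltaPd) (p .tpd) (p .tpp + a) (p .tppP + a) ε = (2 - p .nHoles) / 2 →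
      ε ∈ Set.Icc (51 / 50 : ℝ) (49 / 25 : ℝ) ∧
      fsRatio (p .DeltaPd) (p .tpd) (p .tpp + a) (p .tppP + a) ε ∈ Set.Icc (-(4219 / 10000 : ℝ)) (-(831 / 2500 : ℝ))) emeryBoxBi2223OPK14Src := by
  intro p hp a ε ha' hf
  obtain ⟨hΔ, ha, hb, hc, hν⟩ := emeryBoxBi2223OPK14Src_axRows hp
  rw [← hf] at hν
  exact bi2223OPAxSlab5_window hΔ ha ⟨by linarith [hb.1, ha'.1], by linarith [hb.2, ha'.2]⟩
    ⟨by linarith [hc.1, ha'.1], by linarith [hc.2, ha'.2]⟩ hν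

/-- **Slab 6 on the typed box**: for every parameter vector of `emeryBoxBi2223OPK14Src`, every co-shift `a ∈ [0.3, 0.35]` and every Fermi energy at
which the CO-SHIFTED σ antibonding band holds the box's electrons: `ε ∈ [1.0, 1.92]`, `t′/t ∈ [-0.435, -0.3449]` (MEETS).
[folklore] -/
theorem emeryBoxBi2223OPK14Src_axSlab6 :
    HoldsOn (fun p : EmeryCoord → ℝ => ∀ a ε : ℝ, a ∈ Set.Icc (3 / 10 : ℝ) (7 / 20 : ℝ) →
      abFilling (p .DeltaPd) (p .tpd) (p .tpp + a) (p .tppP + a) ε = (2 - p .nHoles) / 2 →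
      ε ∈ Set.Icc (1 : ℝ) (48 / 25 : ℝ) ∧
      fsRatio (p .DeltaPd) (p .tpd) (p .tpp + a) (p .tppP + a) ε ∈ Set.Icc (-(87 / 200 : ℝ)) (-(3449 / 10000 : ℝ))) emeryBoxBi2223OPK14Src := by
  intro p hp a ε ha' hf
  obtain ⟨hΔ, ha, hb, hc, hν⟩ := emeryBoxBi2223OPK14Src_axRows hp
  rw [← hf] at hν
  exact bi2223OPAxSlab6_window hΔ ha ⟨by linarith [hb.1, ha'.1], by linarith [hb.2, ha'.2]⟩
    ⟨by linarith [hc.1, ha'.1], by linarith [hc.2, ha'.2]⟩ hν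

/-- **Slab 7 on the typed box**: for every parameter vector of `emeryBoxBi2223OPK14Src`, every co-shift `a ∈ [0.35, 0.4]` and every Fermi energy at
which the CO-SHIFTED σ antibonding band holds the box's electrons: `ε ∈ [0.98, 1.9]`, `t′/t ∈ [-0.4471, -0.3567]` (MEETS).
[folklore] -/
theorem emeryBoxBi2223OPK14Src_axSlab7 :
    HoldsOn (fun p : EmeryCoord → ℝ => ∀ a ε : ℝ, a ∈ Set.Icc (7 / 20 : ℝ) (2 / 5 : ℝ) →
      abFilling (p .DeltaPd) (p .tpd) (p .tpp + a) (p .tppP + a) ε = (2 - p .nHoles) / 2 →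
      ε ∈ Set.Icc (49 / 50 : ℝ) (19 / 10 : ℝ) ∧
      fsRatio (p .DeltaPd) (p .tpd) (p .tpp + a) (p .tppP + a) ε ∈ Set.Icc (-(4471 / 10000 : ℝ)) (-(3567 / 10000 : ℝ))) emeryBoxBi2223OPK14Src := by
  intro p hp a ε ha' hf
  obtain ⟨hΔ, ha, hb, hc, hν⟩ := emeryBoxBi2223OPK14Src_axRows hp
  rw [← hf] at hν
  exact bi2223OPAxSlab7_window hΔ ha ⟨by linarith [hb.1, ha'.1], by linarith [hb.2, ha'.2]⟩
    ⟨by linarith [hc.1, ha'.1], by linarith [hc.2, ha'.2]⟩ hν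

/-- **Slab 8 on the typed box**: for every parameter vector of `emeryBoxBi2223OPK14Src`, every co-shift `a ∈ [0.4, 0.5]` and every Fermi energy at
which the CO-SHIFTED σ antibonding band holds the box's electrons: `ε ∈ [0.96, 1.92]`, `t′/t ∈ [-0.4725, -0.366]` (MEETS).
[folklore] -/
theorem emeryBoxBi2223OPK14Src_axSlab8 :
    HoldsOn (fun p : EmeryCoord → ℝ => ∀ a ε : ℝ, a ∈ Set.Icc (2 / 5 : ℝ) (1 / 2 : ℝ) →
      abFilling (p .DeltaPd) (p .tpd) (p .tpp + a) (p .tppP + a) ε = (2 - p .nHoles) / 2 →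
      ε ∈ Set.Icc (24 / 25 : ℝ) (48 / 25 : ℝ) ∧
      fsRatio (p .DeltaPd) (p .tpd) (p .tpp + a) (p .tppP + a) ε ∈ Set.Icc (-(189 / 400 : ℝ)) (-(183 / 500 : ℝ))) emeryBoxBi2223OPK14Src := by
  intro p hp a ε ha' hf
  obtain ⟨hΔ, ha, hb, hc, hν⟩ := emeryBoxBi2223OPK14Src_axRows hp
  rw [← hf] at hν
  exact bi2223OPAxSlab8_window hΔ ha ⟨by linarith [hb.1, ha'.1], by linarith [hb.2, ha'.2]⟩
    ⟨by linarith [hc.1, ha'.1], by linarith [hc.2, ha'.2]⟩ hν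

/-! ## §3 The census verdicts against the E row -/

/-- **INSIDE THE E ROW for every co-shift `a ∈ [0.25, 0.3]`**: the co-shifted `t′/t` lies in `[-0.422, -0.321]`. [folklore] -/
theorem emeryBoxBi2223OPK14Src_axial_inside :
    HoldsOn (fun p : EmeryCoord → ℝ => ∀ a ε : ℝ, a ∈ Set.Icc (1 / 4 : ℝ) (3 / 10 : ℝ) →
      abFilling (p .DeltaPd) (p .tpd) (p .tpp + a) (p .tppP + a) ε = (2 - p .nHoles) / 2 →
      fsRatio (p .DeltaPd) (p .tpd) (p .tpp + a) (p .tppP + a) ε ∈ Set.Icc (-(211 / 500 : ℝ)) (-(321 / 1000 : ℝ))) emeryBoxBi2223OPK14Src := by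
  intro p hp a ε ha' hf
  have h := (emeryBoxBi2223OPK14Src_axSlab5 p hp a ε ha' hf).2
  exact ⟨le_trans (by norm_num) h.1, h.2.trans (by norm_num)⟩

/-! ## §4 The four-orbital reading (transfer theorem `EmeryAxialConductionBand.condFilling_eq_abFilling`) -/

/-- **FOUR-ORBITAL FORM OF THE MATCH**: axial admixture `t_sp²/(ε_s − ε_F) ∈ [0.25, 0.3]` eV puts the conduction-band
`t′/t` INSIDE the E row `[-0.422, -0.321]`. [cite: PavariniEtAl2001, Eqs. (1)–(3), Fig. 3] -/
theorem emeryBoxBi2223OPK14Src_fourOrbital_inside :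
    HoldsOn (fun p : EmeryCoord → ℝ => ∀ εs tsp ε : ℝ, ε < εs →
      tsp ^ 2 / (εs - ε) ∈ Set.Icc (1 / 4 : ℝ) (3 / 10 : ℝ) →
      condFilling (p .DeltaPd) εs (p .tpd) (p .tpp) (p .tppP) tsp ε = (2 - p .nHoles) / 2 →
      fsRatio (p .DeltaPd) (p .tpd) (p .tpp + tsp ^ 2 / (εs - ε)) (p .tppP + tsp ^ 2 / (εs - ε)) ε
        ∈ Set.Icc (-(211 / 500 : ℝ)) (-(321 / 1000 : ℝ))) emeryBoxBi2223OPK14Src := by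
  intro p hp εs tsp ε hε ha hf
  rw [condFilling_eq_abFilling hε] at hf
  exact emeryBoxBi2223OPK14Src_axial_inside p hp _ ε ha hf

end Summit.Ventures.CertifiedManyBodySolver.Downfold.Emery
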